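import Literature.AlgebraicTopology.FundamentalGroup.CellAttachmentPi1
import HarnessLib

/-!
# Transport of inclusion-induced maps on `π₁` (bookkeeping for van Kampen computations)

Topic `Literature/AlgebraicTopology/FundamentalGroup`.  The van Kampen theorems of this
directory (`VanKampenPushout.lean`, `VanKampenEpi.lean`, `VanKampenDeformation.lean`,
`CellAttachmentPi1.lean`) speak about the homomorphisms `VanKampen.inclHom S x₀` /
`VanKampen.inclHomOfSubset h x₀` induced on fundamental groups by inclusions of subsets of one
ambient type `Y`.  Consumers meet the same maps in two other guises, and this file records the
(canonical, commuting) isomorphisms between them, as existence statements together with the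
commuting squares, and the resulting transfer of surjectivity / injectivity / kernels:

* **subspace of a subspace** (`exists_mulEquiv_preimageVal_comm`): for `A ⊆ B ⊆ W ⊆ Y`, the
  maps induced by `A ⊆ B ⊆ W` computed among subsets of `Y` and computed among the subsets
  `W ↓∩ A ⊆ W ↓∩ B` of the subspace `↥W` agree along the canonical isomorphisms
  `π₁(↥A) ≅ π₁(↥(W ↓∩ A))`, `π₁(↥B) ≅ π₁(↥(W ↓∩ B))`;
* **along an embedding** (`exists_mulEquiv_image_comm_of_isEmbedding`): for a topological
  embedding `e : M → Y` and `S ⊆ M`, the map `π₁(↥S, x) → π₁(M, x)` agrees with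
  `π₁(↥(e '' S), e x) → π₁(↥(range e), e x)` along the isomorphisms induced by `e`;
* `FundamentalGroup.map_eq_mapOfEq` (Mathlib's two induced maps agree) and rewriting lemmas
  along equalities of the sets involved.

All proofs are by evaluation on loops (`mapOfEq_apply`).  Everything is proved; no definitions.
(Hatcher, *Algebraic Topology* (2002), §1.1, p. 34: induced homomorphisms are functorial, and a
homeomorphism induces an isomorphism.)

## References

* A. Hatcher, *Algebraic Topology*, Cambridge Univ. Press (2002), §1.1 (p. 34), Prop. 1.18.
  [HatcherAT2002]
-/

noncomputable section

open Set Function Topology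

namespace Literature.AlgebraicTopology.FundamentalGroup

/-! ### Mathlib's `map` versus `mapOfEq … rfl` -/

/-- Mathlib's `FundamentalGroup.map f x` and `FundamentalGroup.mapOfEq f rfl` agree. [folklore] -/
theorem _root_.FundamentalGroup.map_eq_mapOfEq {X Y : Type*} [TopologicalSpace X]
    [TopologicalSpace Y] (f : C(X, Y)) (x : X) :
    _root_.FundamentalGroup.map f x = _root_.FundamentalGroup.mapOfEq f (rfl : f x = f x) := by
  ext p
  induction p using Quotient.ind with
  | _ γ => rw [_root_.FundamentalGroup.mapOfEq_apply]; rfl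

namespace VanKampen

variable {Y : Type*} [TopologicalSpace Y]

/-! ### Rewriting the sets -/

/-- Rewriting source and target sets of `inclHomOfSubset` along equalities does not change
surjectivity. [folklore] -/
theorem surjective_inclHomOfSubset_congr' {S S' T T' : Set Y} (eS : S = S') (eT : T = T')
    (h : S ⊆ T) (h' : S' ⊆ T') {x₀ : Y} (hx : x₀ ∈ S) (hx' : x₀ ∈ S') :
    Function.Surjective (inclHomOfSubset h x₀ hx (h hx)) ↔
      Function.Surjective (inclHomOfSubset h' x₀ hx' (h' hx')) := by
  subst eS eT
  exact Iff.rfl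

/-- Rewriting source and target sets of `inclHomOfSubset` along equalities does not change
injectivity. [folklore] -/
theorem injective_inclHomOfSubset_congr' {S S' T T' : Set Y} (eS : S = S') (eT : T = T')
    (h : S ⊆ T) (h' : S' ⊆ T') {x₀ : Y} (hx : x₀ ∈ S) (hx' : x₀ ∈ S') :
    Function.Injective (inclHomOfSubset h x₀ hx (h hx)) ↔
      Function.Injective (inclHomOfSubset h' x₀ hx' (h' hx')) := by
  subst eS eT
  exact Iff.rfl

/-! ### Subspace of a subspace -/

/-- **The maps induced by `A ⊆ B ⊆ W`, computed in `Y` and in the subspace `↥W`, agree along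
the canonical isomorphisms.**  For `A ⊆ B ⊆ W ⊆ Y` and `x₀ ∈ A` there are isomorphisms
`θ_A : π₁(↥A, x₀) ≅ π₁(↥(W ↓∩ A), x₀)` and `θ_B : π₁(↥B, x₀) ≅ π₁(↥(W ↓∩ B), x₀)` (induced by
the canonical homeomorphisms) such that `inclHom (W ↓∩ A) ∘ θ_A = inclHomOfSubset (A ⊆ W)`,
`inclHom (W ↓∩ B) ∘ θ_B = inclHomOfSubset (B ⊆ W)` and
`inclHomOfSubset (W ↓∩ A ⊆ W ↓∩ B) ∘ θ_A = θ_B ∘ inclHomOfSubset (A ⊆ B)`.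
[cite: HatcherAT2002, §1.1 (p. 34) and Prop. 1.18] -/
theorem exists_mulEquiv_preimageVal_comm {A B W : Set Y} (hAB : A ⊆ B) (hBW : B ⊆ W) {x₀ : Y}
    (hx : x₀ ∈ A) :
    ∃ (θA : _root_.FundamentalGroup A ⟨x₀, hx⟩ ≃*
        _root_.FundamentalGroup ↥(Subtype.val ⁻¹' A : Set W) ⟨⟨x₀, hBW (hAB hx)⟩, hx⟩)
      (θB : _root_.FundamentalGroup B ⟨x₀, hAB hx⟩ ≃*
        _root_.FundamentalGroup ↥(Subtype.val ⁻¹' B : Set W) ⟨⟨x₀, hBW (hAB hx)⟩, hAB hx⟩),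
      (∀ a, inclHom (Subtype.val ⁻¹' A : Set W) ⟨x₀, hBW (hAB hx)⟩ hx (θA a) =
        inclHomOfSubset (hAB.trans hBW) x₀ hx (hBW (hAB hx)) a) ∧
      (∀ b, inclHom (Subtype.val ⁻¹' B : Set W) ⟨x₀, hBW (hAB hx)⟩ (hAB hx) (θB b) =
        inclHomOfSubset hBW x₀ (hAB hx) (hBW (hAB hx)) b) ∧
      (∀ a, inclHomOfSubset (fun _ hw => hAB hw : (Subtype.val ⁻¹' A : Set W) ⊆ Subtype.val ⁻¹' B)
          ⟨x₀, hBW (hAB hx)⟩ hx (hAB hx) (θA a) =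
        θB (inclHomOfSubset hAB x₀ hx (hAB hx) a)) := by
  -- the canonical homeomorphisms
  let ηA : A ≃ₜ ↥(Subtype.val ⁻¹' A : Set W) :=
    { toFun := fun a => ⟨⟨a, hBW (hAB a.2)⟩, a.2⟩
      invFun := fun w => ⟨w.1, w.2⟩
      left_inv := fun _ => rfl
      right_inv := fun _ => rfl
      continuous_toFun := (continuous_subtype_val.subtype_mk _).subtype_mk _
      continuous_invFun := (continuous_subtype_val.comp continuous_subtype_val).subtype_mk _ }
  let ηB : B ≃ₜ ↥(Subtype.val ⁻¹' B : Set W) :=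
    { toFun := fun b => ⟨⟨b, hBW b.2⟩, b.2⟩
      invFun := fun w => ⟨w.1, w.2⟩
      left_inv := fun _ => rfl
      right_inv := fun _ => rfl
      continuous_toFun := (continuous_subtype_val.subtype_mk _).subtype_mk _
      continuous_invFun := (continuous_subtype_val.comp continuous_subtype_val).subtype_mk _ }
  have hηA : ηA ⟨x₀, hx⟩ = ⟨⟨x₀, hBW (hAB hx)⟩, hx⟩ := rfl
  have hηB : ηB ⟨x₀, hAB hx⟩ = ⟨⟨x₀, hBW (hAB hx)⟩, hAB hx⟩ := rfl
  refine ⟨fundamentalGroupEquivOfHomeomorph ηA hηA, fundamentalGroupEquivOfHomeomorph ηB hηB,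
    fun a => ?_, fun b => ?_, fun a => ?_⟩
  · rw [fundamentalGroupEquivOfHomeomorph_apply]
    induction a using PushoutData.ind_fromPath with
    | h γ =>
      have e₁ : _root_.FundamentalGroup.mapOfEq (ηA : C(A, ↥(Subtype.val ⁻¹' A : Set W))) hηA
            (_root_.FundamentalGroup.fromPath (Path.Homotopic.Quotient.mk γ)) =
          _root_.FundamentalGroup.fromPath (Path.Homotopic.Quotient.mk
            ((γ.map ηA.continuous).cast rfl rfl)) := by
        rw [_root_.FundamentalGroup.mapOfEq_apply]
        rfl
      have e₂ : inclHomOfSubset (hAB.trans hBW) x₀ hx (hBW (hAB hx))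
            (_root_.FundamentalGroup.fromPath (Path.Homotopic.Quotient.mk γ)) =
          _root_.FundamentalGroup.fromPath (Path.Homotopic.Quotient.mk
            ((γ.map (continuous_inclusion (hAB.trans hBW))).cast rfl rfl)) := by
        rw [inclHomOfSubset, _root_.FundamentalGroup.mapOfEq_apply]
        rfl
      rw [e₁, e₂]
      refine (inclHom_fromPath _ _).trans ?_
      exact congrArg (fun p => _root_.FundamentalGroup.fromPath (Path.Homotopic.Quotient.mk p))
        (by ext t; rfl)
  · rw [fundamentalGroupEquivOfHomeomorph_apply]
    induction b using PushoutData.ind_fromPath with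
    | h γ =>
      have e₁ : _root_.FundamentalGroup.mapOfEq (ηB : C(B, ↥(Subtype.val ⁻¹' B : Set W))) hηB
            (_root_.FundamentalGroup.fromPath (Path.Homotopic.Quotient.mk γ)) =
          _root_.FundamentalGroup.fromPath (Path.Homotopic.Quotient.mk
            ((γ.map ηB.continuous).cast rfl rfl)) := by
        rw [_root_.FundamentalGroup.mapOfEq_apply]
        rfl
      have e₂ : inclHomOfSubset hBW x₀ (hAB hx) (hBW (hAB hx))
            (_root_.FundamentalGroup.fromPath (Path.Homotopic.Quotient.mk γ)) =
          _root_.FundamentalGroup.fromPath (Path.Homotopic.Quotient.mk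
            ((γ.map (continuous_inclusion hBW)).cast rfl rfl)) := by
        rw [inclHomOfSubset, _root_.FundamentalGroup.mapOfEq_apply]
        rfl
      rw [e₁, e₂]
      refine (inclHom_fromPath _ _).trans ?_
      exact congrArg (fun p => _root_.FundamentalGroup.fromPath (Path.Homotopic.Quotient.mk p))
        (by ext t; rfl)
  · rw [fundamentalGroupEquivOfHomeomorph_apply, fundamentalGroupEquivOfHomeomorph_apply]
    induction a using PushoutData.ind_fromPath with
    | h γ =>
      rw [inclHomOfSubset, inclHomOfSubset, _root_.FundamentalGroup.mapOfEq_apply,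
        _root_.FundamentalGroup.mapOfEq_apply, _root_.FundamentalGroup.mapOfEq_apply,
        _root_.FundamentalGroup.mapOfEq_apply]
      rfl

/-! ### Along an embedding -/

/-- **The map induced by `S ⊆ M` on `π₁`, transported along an embedding `e : M → Y`.**  For a
topological embedding `e`, `S ⊆ M` and `x ∈ S` there are isomorphisms
`θ_S : π₁(↥S, x) ≅ π₁(↥(e '' S), e x)` and `θ_M : π₁(M, x) ≅ π₁(↥(range e), e x)` (induced by
the homeomorphisms onto the images) with
`inclHomOfSubset (e '' S ⊆ range e) ∘ θ_S = θ_M ∘ inclHom S`.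
[cite: HatcherAT2002, §1.1 (p. 34) and Prop. 1.18] -/
theorem exists_mulEquiv_image_comm_of_isEmbedding {M : Type*} [TopologicalSpace M] {e : M → Y}
    (he : IsEmbedding e) {S : Set M} {x : M} (hx : x ∈ S) :
    ∃ (θS : _root_.FundamentalGroup S ⟨x, hx⟩ ≃*
        _root_.FundamentalGroup ↥(e '' S) ⟨e x, mem_image_of_mem e hx⟩)
      (θM : _root_.FundamentalGroup M x ≃* _root_.FundamentalGroup ↥(range e) ⟨e x, mem_range_self x⟩),
      ∀ a, inclHomOfSubset (image_subset_range e S) (e x) (mem_image_of_mem e hx)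
          (mem_range_self x) (θS a) = θM (inclHom S x hx a) := by
  -- the homeomorphisms onto the images
  let ηM : M ≃ₜ ↥(range e) := he.toHomeomorph
  have hηM : ∀ y, ηM y = ⟨e y, mem_range_self y⟩ := fun y => rfl
  have heS : IsEmbedding (fun s : S => e s) := he.comp IsEmbedding.subtypeVal
  have hrange : range (fun s : S => e s) = e '' S := by
    ext y
    simp only [mem_range, mem_image, Subtype.exists, exists_prop]
  let ηS : S ≃ₜ ↥(e '' S) := heS.toHomeomorph.trans (Homeomorph.setCongr hrange)
  have hηS : ∀ s, (ηS s : Y) = e s := fun s => rfl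
  have hηSx : ηS ⟨x, hx⟩ = ⟨e x, mem_image_of_mem e hx⟩ := Subtype.ext (hηS _)
  refine ⟨fundamentalGroupEquivOfHomeomorph ηS hηSx, fundamentalGroupEquivOfHomeomorph ηM (hηM x),
    fun a => ?_⟩
  rw [fundamentalGroupEquivOfHomeomorph_apply, fundamentalGroupEquivOfHomeomorph_apply]
  induction a using PushoutData.ind_fromPath with
  | h γ =>
    rw [inclHomOfSubset, inclHom, _root_.FundamentalGroup.mapOfEq_apply,
      _root_.FundamentalGroup.mapOfEq_apply, _root_.FundamentalGroup.mapOfEq_apply,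
      _root_.FundamentalGroup.mapOfEq_apply]
    exact congrArg (fun p => _root_.FundamentalGroup.fromPath (Path.Homotopic.Quotient.mk p))
      (by ext t; rfl)

/-- **Surjectivity of `π₁(↥S, x) → π₁(M, x)` transported along an embedding.** [cite: HatcherAT2002, Prop. 1.18] -/
theorem surjective_inclHom_iff_image_of_isEmbedding {M : Type*} [TopologicalSpace M] {e : M → Y}
    (he : IsEmbedding e) {S : Set M} {x : M} (hx : x ∈ S) :
    Function.Surjective (inclHom S x hx) ↔
      Function.Surjective (inclHomOfSubset (image_subset_range e S) (e x) (mem_image_of_mem e hx)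
        (mem_range_self x)) := by
  obtain ⟨θS, θM, h⟩ := exists_mulEquiv_image_comm_of_isEmbedding he hx
  exact surjective_iff_of_mulEquiv_comm _ _ θS θM h

/-- **Injectivity of `π₁(↥S, x) → π₁(M, x)` transported along an embedding.** [cite: HatcherAT2002, Prop. 1.18] -/
theorem injective_inclHom_iff_image_of_isEmbedding {M : Type*} [TopologicalSpace M] {e : M → Y}
    (he : IsEmbedding e) {S : Set M} {x : M} (hx : x ∈ S) :
    Function.Injective (inclHom S x hx) ↔
      Function.Injective (inclHomOfSubset (image_subset_range e S) (e x) (mem_image_of_mem e hx)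
        (mem_range_self x)) := by
  obtain ⟨θS, θM, h⟩ := exists_mulEquiv_image_comm_of_isEmbedding he hx
  exact injective_iff_of_mulEquiv_comm _ _ θS θM h

end VanKampen

end Literature.AlgebraicTopology.FundamentalGroup
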